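import Mathlib
import HarnessLib
import Summits.ResolutionOfSingularities.ResolutionOfSingularities.Theses.CleanCovers
import Literature.AlgebraicGeometry.Resolution.LogRegularSchemeEtale

/-!
# Birth skeleton (BC3) of the child `LogRegularPatching` of `CleanCovers.CoverResolution`

Line `toric-two-model-patching` (Zariski 1944 / Piltant 2013 Prop. 5.1, Cor. 5.7, at the toric
level and over base opens): (`stub_extendModel`) a proper birational log-regular model over
`f⁻¹(B)` extends, for `B ≤ C`, to a proper birational model over `f⁻¹(C)` that is still log
regular over `B` (closure of the graph in a Nagata compactification; for projective models:
extend the blown-up ideal, EGA I 9.4.7); (`stub_patchTwoModels`, the crux of the line = Piltant's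
two-model patching with `P = P_logreg`) two proper birational models over `f⁻¹(B₁ ∪ B₂)`, log
regular over `B₁` resp. `B₂`, are dominated by / can be merged into one proper birational model
log regular everywhere. `logRegularPatching_of` composes them. Conclusion = the child's statement
VERBATIM (local mirror; after the split it is `Theses.CleanCovers.LogRegularPatching` by `Iff.rfl`).
-/

set_option linter.dupNamespace false

namespace Summit.ResolutionOfSingularities.ResolutionOfSingularities.Cruxes.LogRegularPatching.Birth

open CategoryTheory AlgebraicGeometry TopologicalSpace
open Literature.AlgebraicGeometry.Resolution

/-- VERBATIM mirror of the child statement `CleanCovers.LogRegularPatching` (not yet a route decl: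
the split is pending). -/
def LogRegularPatching : Prop :=
  ∀ p : ℕ, p.Prime → ∀ (k : Type) [Field k] [CharP k p] [PerfectField k] (n : ℕ) (X : AlgebraicGeometry.Scheme.{0}) (f : X ⟶ (Literature.AlgebraicGeometry.Motives.projectiveSpace n k).left), AlgebraicGeometry.IsIntegral X → AlgebraicGeometry.IsFinite f → Function.Surjective f.base → (letI := MvPolynomial.gradedAlgebra (σ := Fin (n + 1)) (R := k); AlgebraicGeometry.Etale (f ∣_ (AlgebraicGeometry.Proj.basicOpen (MvPolynomial.homogeneousSubmodule (Fin (n + 1)) k) (MvPolynomial.X (Fin.last n))))) → ∀ B₁ B₂ : (Literature.AlgebraicGeometry.Motives.projectiveSpace n k).left.Opens, (∃ (Y : AlgebraicGeometry.Scheme.{0}) (π : Y ⟶ ((f ⁻¹ᵁ B₁ : X.Opens) : AlgebraicGeometry.Scheme.{0})), AlgebraicGeometry.IsProper π ∧ Literature.AlgebraicGeometry.Resolution.IsBirational π ∧ Literature.AlgebraicGeometry.Resolution.Scheme.IsLogRegularEtale Y) → (∃ (Y : AlgebraicGeometry.Scheme.{0}) (π : Y ⟶ ((f ⁻¹ᵁ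 B₂ : X.Opens) : AlgebraicGeometry.Scheme.{0})), AlgebraicGeometry.IsProper π ∧ Literature.AlgebraicGeometry.Resolution.IsBirational π ∧ Literature.AlgebraicGeometry.Resolution.Scheme.IsLogRegularEtale Y) → ∃ (Y : AlgebraicGeometry.Scheme.{0}) (π : Y ⟶ ((f ⁻¹ᵁ (B₁ ⊔ B₂) : X.Opens) : AlgebraicGeometry.Scheme.{0})), AlgebraicGeometry.IsProper π ∧ Literature.AlgebraicGeometry.Resolution.IsBirational π ∧ Literature.AlgebraicGeometry.Resolution.Scheme.IsLogRegularEtale Y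

/-- STUB 1 (extension of a local model): for base opens `B ≤ C`, a proper birational log-regular
model of `f⁻¹(B)` extends to a proper birational model `ρ : Z → f⁻¹(C)` whose part over `B` is log
regular (fs étale charts). Nagata compactification + scheme-theoretic closure (the part over `B`
is unchanged because `Y → f⁻¹(B)` is proper and dense in the closure). -/
theorem stub_extendModel : ∀ p : ℕ, p.Prime → ∀ (k : Type) [Field k] [CharP k p] [PerfectField k] (n : ℕ) (X : AlgebraicGeometry.Scheme.{0}) (f : X ⟶ (Literature.AlgebraicGeometry.Motives.projectiveSpace n k).left), AlgebraicGeometry.IsIntegral X → AlgebraicGeometry.IsFinite f → Function.Surjective f.base → (letI := MvPolynomial.gradedAlgebra (σ := Fin (n + 1)) (R := k); AlgebraicGeometry.Etale (f ∣_ (AlgebraicGeometry.Proj.basicOpen (MvPolynomial.homogeneousSubmodule (Fin (n + 1)) k) (MvPolynomial.X (Fin.last n))))) → ∀ B C : (Literature.AlgebraicGeometry.Motives.projectiveSpace n k).left.Opens, B ≤ C → (∃ (Y : AlgebraicGeometry.Scheme.{0}) (π : Y ⟶ ((f ⁻¹ᵁ B : X.Opens) : AlgebraicGeometry.Scheme.{0})),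 AlgebraicGeometry.IsProper π ∧ Literature.AlgebraicGeometry.Resolution.IsBirational π ∧ Literature.AlgebraicGeometry.Resolution.Scheme.IsLogRegularEtale Y) → ∃ (Z : AlgebraicGeometry.Scheme.{0}) (ρ : Z ⟶ ((f ⁻¹ᵁ C : X.Opens) : AlgebraicGeometry.Scheme.{0})), AlgebraicGeometry.IsProper ρ ∧ Literature.AlgebraicGeometry.Resolution.IsBirational ρ ∧ Literature.AlgebraicGeometry.Resolution.Scheme.IsLogRegularEtale ((ρ ⁻¹ᵁ ((f ⁻¹ᵁ C).ι ⁻¹ᵁ (f ⁻¹ᵁ B)) : Z.Opens) : AlgebraicGeometry.Scheme.{0}) := by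
  sorry

/-- STUB 2 (two-model patching at the toric level — the crux of the line): two proper birational
models of `f⁻¹(B₁ ∪ B₂)`, log regular over `B₁` and over `B₂` respectively, can be merged into a
proper birational model that is log regular everywhere (Piltant 2013 Prop. 5.1 with `P` = "log
regular", for Kedlaya covers; open in dimension `≥ 4`). -/
theorem stub_patchTwoModels : ∀ p : ℕ, p.Prime → ∀ (k : Type) [Field k] [CharP k p] [PerfectField k] (n : ℕ) (X : AlgebraicGeometry.Scheme.{0}) (f : X ⟶ (Literature.AlgebraicGeometry.Motives.projectiveSpace n k).left), AlgebraicGeometry.IsIntegral X → AlgebraicGeometry.IsFinite f → Function.Surjective f.base → (letI := MvPolynomial.gradedAlgebra (σ := Fin (n + 1)) (R := k); AlgebraicGeometry.Etale (f ∣_ (AlgebraicGeometry.Proj.basicOpen (MvPolynomial.homogeneousSubmodule (Fin (n + 1)) k) (MvPolynomial.X (Fin.last n))))) → ∀ B₁ B₂ : (Literature.AlgebraicGeometry.Motives.projectiveSpace n k).left.Opens, (∃ (Z : AlgebraicGeometry.Scheme.{0}) (ρ : Z ⟶ ((f ⁻¹ᵁ (B₁ ⊔ B₂) : X.Opens) :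 AlgebraicGeometry.Scheme.{0})), AlgebraicGeometry.IsProper ρ ∧ Literature.AlgebraicGeometry.Resolution.IsBirational ρ ∧ Literature.AlgebraicGeometry.Resolution.Scheme.IsLogRegularEtale ((ρ ⁻¹ᵁ ((f ⁻¹ᵁ (B₁ ⊔ B₂)).ι ⁻¹ᵁ (f ⁻¹ᵁ B₁)) : Z.Opens) : AlgebraicGeometry.Scheme.{0})) → (∃ (Z : AlgebraicGeometry.Scheme.{0}) (ρ : Z ⟶ ((f ⁻¹ᵁ (B₁ ⊔ B₂) : X.Opens) : AlgebraicGeometry.Scheme.{0})), AlgebraicGeometry.IsProper ρ ∧ Literature.AlgebraicGeometry.Resolution.IsBirational ρ ∧ Literature.AlgebraicGeometry.Resolution.Scheme.IsLogRegularEtale ((ρ ⁻¹ᵁ ((f ⁻¹ᵁ (B₁ ⊔ B₂)).ι ⁻¹ᵁ (f ⁻¹ᵁ B₂)) : Z.Opens) : AlgebraicGeometry.Scheme.{0})) → ∃ (Y : AlgebraicGeometry.Scheme.{0}) (π : Y ⟶ ((f ⁻¹ᵁ (B₁ ⊔ B₂) : X.Opens) : AlgebraicGeometry.Scheme.{0})),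 AlgebraicGeometry.IsProper π ∧ Literature.AlgebraicGeometry.Resolution.IsBirational π ∧ Literature.AlgebraicGeometry.Resolution.Scheme.IsLogRegularEtale Y := by
  sorry

/-- `LogRegularPatching` from the two stubs: extend both local models to `f⁻¹(B₁ ∪ B₂)`
(`le_sup_left`, `le_sup_right`), then patch. [folklore] -/
theorem logRegularPatching_of :
    (∀ p : ℕ, p.Prime → ∀ (k : Type) [Field k] [CharP k p] [PerfectField k] (n : ℕ) (X : AlgebraicGeometry.Scheme.{0}) (f : X ⟶ (Literature.AlgebraicGeometry.Motives.projectiveSpace n k).left), AlgebraicGeometry.IsIntegral X → AlgebraicGeometry.IsFinite f → Function.Surjective f.base → (letI := MvPolynomial.gradedAlgebra (σ := Fin (n + 1)) (R := k); AlgebraicGeometry.Etale (f ∣_ (AlgebraicGeometry.Proj.basicOpen (MvPolynomial.homogeneousSubmodule (Fin (n + 1)) k) (MvPolynomial.X (Fin.last n))))) → ∀ B C : (Literature.AlgebraicGeometry.Motives.projectiveSpace n k).left.Opens, B ≤ C → (∃ (Y : AlgebraicGeometry.Scheme.{0}) (π : Y ⟶ ((f ⁻¹ᵁ B : X.Opens)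 : AlgebraicGeometry.Scheme.{0})), AlgebraicGeometry.IsProper π ∧ Literature.AlgebraicGeometry.Resolution.IsBirational π ∧ Literature.AlgebraicGeometry.Resolution.Scheme.IsLogRegularEtale Y) → ∃ (Z : AlgebraicGeometry.Scheme.{0}) (ρ : Z ⟶ ((f ⁻¹ᵁ C : X.Opens) : AlgebraicGeometry.Scheme.{0})), AlgebraicGeometry.IsProper ρ ∧ Literature.AlgebraicGeometry.Resolution.IsBirational ρ ∧ Literature.AlgebraicGeometry.Resolution.Scheme.IsLogRegularEtale ((ρ ⁻¹ᵁ ((f ⁻¹ᵁ C).ι ⁻¹ᵁ (f ⁻¹ᵁ B)) : Z.Opens) : AlgebraicGeometry.Scheme.{0})) →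
    (∀ p : ℕ, p.Prime → ∀ (k : Type) [Field k] [CharP k p] [PerfectField k] (n : ℕ) (X : AlgebraicGeometry.Scheme.{0}) (f : X ⟶ (Literature.AlgebraicGeometry.Motives.projectiveSpace n k).left), AlgebraicGeometry.IsIntegral X → AlgebraicGeometry.IsFinite f → Function.Surjective f.base → (letI := MvPolynomial.gradedAlgebra (σ := Fin (n + 1)) (R := k); AlgebraicGeometry.Etale (f ∣_ (AlgebraicGeometry.Proj.basicOpen (MvPolynomial.homogeneousSubmodule (Fin (n + 1)) k) (MvPolynomial.X (Fin.last n))))) → ∀ B₁ B₂ : (Literature.AlgebraicGeometry.Motives.projectiveSpace n k).left.Opens, (∃ (Z : AlgebraicGeometry.Scheme.{0}) (ρ : Z ⟶ ((f ⁻¹ᵁ (B₁ ⊔ B₂) : X.Opens) : AlgebraicGeometry.Scheme.{0})), AlgebraicGeometry.IsProper ρ ∧ Literature.AlgebraicGeometry.Resolution.IsBirational ρ ∧ Literature.AlgebraicGeometry.Resolution.Scheme.IsLogRegularEtale ((ρ ⁻¹ᵁ ((f ⁻¹ᵁ (B₁ ⊔ B₂)).ι ⁻¹ᵁ (f ⁻¹ᵁ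 B₁)) : Z.Opens) : AlgebraicGeometry.Scheme.{0})) → (∃ (Z : AlgebraicGeometry.Scheme.{0}) (ρ : Z ⟶ ((f ⁻¹ᵁ (B₁ ⊔ B₂) : X.Opens) : AlgebraicGeometry.Scheme.{0})), AlgebraicGeometry.IsProper ρ ∧ Literature.AlgebraicGeometry.Resolution.IsBirational ρ ∧ Literature.AlgebraicGeometry.Resolution.Scheme.IsLogRegularEtale ((ρ ⁻¹ᵁ ((f ⁻¹ᵁ (B₁ ⊔ B₂)).ι ⁻¹ᵁ (f ⁻¹ᵁ B₂)) : Z.Opens) : AlgebraicGeometry.Scheme.{0})) → ∃ (Y : AlgebraicGeometry.Scheme.{0}) (π : Y ⟶ ((f ⁻¹ᵁ (B₁ ⊔ B₂) : X.Opens) : AlgebraicGeometry.Scheme.{0})), AlgebraicGeometry.IsProper π ∧ Literature.AlgebraicGeometry.Resolution.IsBirational π ∧ Literature.AlgebraicGeometry.Resolution.Scheme.IsLogRegularEtale Y) →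
    LogRegularPatching := by
  intro h1 h2 p hp k _ _ _ n X f hint hfin hsurj het B₁ B₂ hB₁ hB₂
  exact h2 p hp k n X f hint hfin hsurj het B₁ B₂
    (h1 p hp k n X f hint hfin hsurj het B₁ (B₁ ⊔ B₂) le_sup_left hB₁)
    (h1 p hp k n X f hint hfin hsurj het B₂ (B₁ ⊔ B₂) le_sup_right hB₂)

end Summit.ResolutionOfSingularities.ResolutionOfSingularities.Cruxes.LogRegularPatching.Birth
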